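import Literature.MathematicalPhysics.QuantumFieldTheory.Balaban1983to89.Node00.CarriersYU

/-!
# NODE 00 — THE [B9] CARRIER BUNDLE OVER THE CODED CARRIER WITH THE SITE TRANSPORTER AND THE BOND-AVERAGE LETTER AS PARAMETERS: `carriersYUPar`,
# `Y9OfRecordUPar`, `Y9OfRecordUPbPar` (CASCADE-K, piece K0) — Balaban, Commun. Math. Phys. **99** (1985) 389–434, Thm 3.4 p.400, (3.37)–(3.38) p.396, (3.115) p.418

[cite: Balaban1985BackgroundPropagators, Thm 3.4 p.400 («extend … as analytic functions of A»), (3.37)–(3.38) p.396, Thm 3.2 (3.48) p.398, (3.42)–(3.47) pp.397–398,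
(3.84)–(3.86) p.407, Cor. 3.6 p.408, (3.115) p.418 (print's averaging operation and its transporter), Thms 3.1–3.15 pp.397–432 (the carriers)]

Cell `pub-ymgap`, seat `pub-ymgap-node00-def-Y` (g32).  WHY THIS FILE (director-ym №383 «GO CASCADE-K», fleet INBOX 2026-08-30 l.18954, on dag-n06-d g24's ⚑ LOCATED-K
l.18944; piece K0 = def-Y's; the cascade is PARAMETRIC ONCE, not twinned).  def-Y's bundle `Node00.CarriersYU.carriersYU P G f b ιB C38 ops` (FILE 68, g27) pins FOUR slots
to the record's SYMMETRIC site transporter `parSymY` independently of the operator layer `ops`: `G′ := KSCU … (parSymY _) …`, `G := KACU … (GAY _ parSymY parBY (GpY _ parSymY)) parBY …`,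
`C⁻¹ := pullS … (CinvY P f G (fun j ↦ parSymY _) j)` and the analyticity slot `IsAnKY … (parSymY _) b …`.  The leaf lemma over it (`B9LeafXCodedKnitU.b9LeafX_carriersYU`) closes
only through the pins `(ops (f j)).Gp ∕ .GA ∕ .Cinv = … parSymY …` — `rfl` at the symmetric operator layer of record, FALSE at def-Y's v11 KNIT record
(`OpsYRecordV11.lettersYOfRecordV11K`: `.parS = parKnitY`, `.Gp = GpY parKnitY`, `.C = CY parKnitY (GpY parKnitY)`, `.GA = GAQY qKnit qsKnit parKnitY (G′_phys parKnitY)`), so the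
knit instance cannot enter the N06 certificate of record through a re-keying edition of the bundle.  dag-n06-c's constituents are ALREADY parametric in the transporter
(`KSCU P G x par`, `IsAnKY P G x par b`, `CinvY P f G par`) and in the bond-average letter (`KACU P G x OA parB`); only the bundle pinned them.

THIS FILE is the bundle with those two letters as PARAMETERS — `par : ∀ j, SiteParY 𝔸 (f j).toKIdx` (print's site transporter along the subfamily, (3.115)) and
`OA : ∀ j, BondOpY 𝔸 (f j).toKIdx` (the bond-average operator `G` is read from) — every other slot VERBATIM `carriersYU`'s:
* §2 `carriersYUPar P G f b ιB C38 par OA ops` with ★ `carriersYU_eq_carriersYUPar : carriersYU … ops = carriersYUPar … (fun j ↦ parSymY _) (fun j ↦ GAY _ parSymY parBY (GpY _ parSymY)) ops`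
  (`rfl`: today's bundle IS the instance at the symmetric letters — nothing landed at v ≤ 11 is touched) and the projections of `CarriersYU` §2a–§2c re-read at the parameters
  (`rfl` ∕ `Iff.rfl`);
* §3 at the record (`M_N(ℂ)`, `SU(N)`): `Y9OfRecordUPar N θ Mstar P ops f b ιB C38 par OA` and, at the record's reading of print's class `P := extraYPb`, `Y9OfRecordUPbPar N θ Mstar
  ops f b ιB C38 par OA`, with `Y9OfRecordU_eq_Y9OfRecordUPar`, `Y9OfRecordUPb_eq_Y9OfRecordUPbPar` (`rfl`) and the faces of `CarriersYU` §3–§3b at the parameters.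
The KNIT instance (`par := fun j ↦ parKnitY _`, `OA := fun j ↦ GAQY _ (qKnitOfRecord …) (qsKnitOfRecord …) (parKnitY _) (G′_phys (parKnitY _))`) is the one-line specialisation typed
in the sequel next to def-Y's v11 knit record; CASCADE-K's K1 (dag-n06-c: the coded Sect.-B chain ∕ the leaf lemma at a parameter `par`) and K3 (dag-n06-d: the certificate skeleton
«K») quantify over `par ∕ OA` through this module.

HONEST STATUS.  Definitions and `rfl` ∕ `Iff.rfl` projections only (a re-parametrisation of a landed bundle; the instance identities are syntactic); NAMES objects, asserts
nothing about them; no estimate of [B9] is claimed; the N06 certificate is not touched here.  0 `sorry`.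
-/

noncomputable section

namespace Literature.MathematicalPhysics.QuantumFieldTheory.Balaban1983to89.Node00

open DagBinding (PrintedCarriers9X)
open B9PinCarriersKLevelV1 (OperatorLayerY)
open B9PinMembersKLevelV1 (MemberY geo9Y bg9Y)
open B9BackgroundsKLevelV1P (bg9KP)
open B9BackgroundsKLevelV1R (bg9YR kernelFamilyR kernelFamilyRY siteKernelR fineKernelR rwExpansionR rwKernelExpansionR hKernelR hKernelRY)
open B9SectBCodedClassR (RegExtraY regC335 regC336 bg9YC extraY extraYPb)
open B9SectBGpLettersY (GVal)
open B9PinGeometryKLevelV1 (dOmegaY OmKY inΛY unitDistY InCubeY c35Y)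
open B9Eq360DeltaPrimeAY (AfldY)
open B9SectBCodedCarrier (CCfg Coding pullK pullS)
open B9SectBCodedCarrierPullbacks (pullF pullH pullRW pullRWK pullC pullPK pullPH pullPK₀)
open B9SectBGpFrameCodedYR (codingYx)
open B9SectBCodedReadingsUR (KSCU KACU)
open B9SectBCodedChainAnR (IsAnKY)
open B9SectBKerFrameCodedYR (CinvY)
open B6Ineq2142KLevelV1 (β)
open B9SectBCodedClassGY (C37GY)
open B7Prop2SpecialUnitary (specialUnitaryUnits)
open scoped Matrix.Norms.L2Operator

/-! ## §2. The bundle over the coded carrier as a function of the operator layer, THE SITE TRANSPORTER `par` AND THE BOND-AVERAGE LETTER `OA` -/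

section Bundle

variable {d ℓ : ℕ} {hd : 1 ≤ d + 1} {hL : Odd (ℓ + 1) ∧ 1 < ℓ + 1} {b₀ b₁ : ℝ} {Mstar : ℕ}
variable {𝔸 : Type} [NormedRing 𝔸] [NormedAlgebra ℂ 𝔸] [CompleteSpace 𝔸] (P : RegExtraY d ℓ hd hL b₀ b₁ Mstar 𝔸) (G : Subgroup 𝔸ˣ)
  {J : Type} (f : J → MemberY d ℓ hd hL b₀ b₁ Mstar) {ι : Type} [Fintype ι] (b : Module.Basis ι ℝ 𝔸)
  (ιB : ∀ j : J, BlkY (f j).toKIdx → IBondY (f j).toKIdx) (C38 : ∀ j : J, ℝ → CfgY 𝔸 (f j).toKIdx → AfldY 𝔸 (f j).toKIdx → Prop)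
  (par : ∀ j : J, SiteParY 𝔸 (f j).toKIdx) (OA : ∀ j : J, BondOpY 𝔸 (f j).toKIdx)
  (ops : ∀ x : MemberY d ℓ hd hL b₀ b₁ Mstar, OperatorLayerY d ℓ hd hL b₀ b₁ Mstar 𝔸 G x)

/-- ★★★ **THE [B9] CARRIER BUNDLE OVER THE CODED CARRIER, PARAMETRIC IN THE SITE TRANSPORTER AND THE BOND-AVERAGE LETTER**: `carriersYU` verbatim except
`G′ := KSCU … (par j) …`, `G := KACU … (OA j) parBY …`, `C⁻¹ := pullS … (CinvY P f G par j)`, analyticity `IsAnKY … (par j) b …`.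
[cite: Balaban1985BackgroundPropagators, Thm 3.4 p.400 («extend … as analytic functions of A»), (3.37)–(3.38) p.396, (3.115) p.418, Thms 3.1–3.15 pp.397–432 (the carriers)] -/
def carriersYUPar : PrintedCarriers9X where
  I9 := J
  d9 := d + 1
  c35 := c35Y
  geo9 := fun j => geo9Y (f j)
  bg9 := fun j => (codingYU P G f ιB C38 j).bg
  InCube := fun j => InCubeY (f j)
  Gp := fun j => KSCU P G (f j) (par j) (C37GY G (f j) (ιB j) (cqY d)) (C38 j)
  GA := fun j => KACU P G (f j) (OA j) (parBY (f j).toKIdx) (C37GY G (f j) (ιB j) (cqY d)) (C38 j)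
  Cinv := fun j => pullS (codingYU P G f ιB C38 j) (CinvY P f G par j)
  IsAnalyticExt := fun j => IsAnKY P G (f j) (par j) b (C37GY G (f j) (ιB j) (cqY d)) (C38 j)
  E37 := fun j => pullRW (codingYU P G f ιB C38 j) (rwExpansionR (regC335 𝔸 G P) (regC336 𝔸 G P) (ops (f j)).E37)
  EK39 := fun j => pullRWK (codingYU P G f ιB C38 j) (rwKernelExpansionR (regC335 𝔸 G P) (regC336 𝔸 G P) (ops (f j)).EK39)
  E310 := fun j => pullRW (codingYU P G f ιB C38 j) (rwExpansionR (regC335 𝔸 G P) (regC336 𝔸 G P) (ops (f j)).E310)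
  PosDef := fun j n => pullC (codingYU P G f ιB C38 j) ((ops (f j)).PosDef n)
  GD := fun j => pullK (codingYU P G f ιB C38 j) (kernelFamilyR (regC335 𝔸 G P) (regC336 𝔸 G P) (ops (f j)).GD)
  G₁ := fun j => pullK (codingYU P G f ιB C38 j) (kernelFamilyR (regC335 𝔸 G P) (regC336 𝔸 G P) (ops (f j)).G₁)
  H := fun j => pullH (codingYU P G f ιB C38 j) (hKernelR (regC335 𝔸 G P) (regC336 𝔸 G P) (ops (f j)).H)
  H₁ := fun j => pullH (codingYU P G f ιB C38 j) (hKernelR (regC335 𝔸 G P) (regC336 𝔸 G P) (ops (f j)).H₁)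
  HasRWExp := fun j => pullPK (codingYU P G f ιB C38 j) (fun K => (ops (f j)).HasRWExp (kernelFamilyRY K))
  HasRWExpH := fun j => pullPH (codingYU P G f ιB C38 j) (fun K => (ops (f j)).HasRWExpH (hKernelRY K))
  PosDefK := fun j => pullPK₀ (codingYU P G f ιB C38 j) (fun K => (ops (f j)).PosDefK (kernelFamilyRY K))
  GG := fun j => pullK (codingYU P G f ιB C38 j) (kernelFamilyR (regC335 𝔸 G P) (regC336 𝔸 G P) (ops (f j)).GG)
  Kdiff := fun j => pullK (codingYU P G f ιB C38 j) (kernelFamilyR (regC335 𝔸 G P) (regC336 𝔸 G P) (ops (f j)).Kdiff)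
  dOmega := fun j => dOmegaY (f j)
  Ck := fun j => pullS (codingYU P G f ιB C38 j) (siteKernelR (regC335 𝔸 G P) (regC336 𝔸 G P) (ops (f j)).Ck)
  inΛ := fun j => inΛY (f j)
  unitDist := fun j => unitDistY (f j)
  GivenBy3185 := fun j => pullC (codingYU P G f ιB C38 j) (ops (f j)).GivenBy3185
  HasRWExpC := fun j => pullC (codingYU P G f ιB C38 j) (ops (f j)).HasRWExpC
  P349 := fun j => pullF (codingYU P G f ιB C38 j) (fineKernelR (regC335 𝔸 G P) (regC336 𝔸 G P) (ops (f j)).P349)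
  QGQinv := fun j => pullS (codingYU P G f ιB C38 j) (siteKernelR (regC335 𝔸 G P) (regC336 𝔸 G P) (ops (f j)).QGQinv)
  QG1Qinv := fun j => pullS (codingYU P G f ιB C38 j) (siteKernelR (regC335 𝔸 G P) (regC336 𝔸 G P) (ops (f j)).QG1Qinv)
  OmK := fun j => OmKY (f j)

/-- ★ **TODAY's BUNDLE IS THE INSTANCE AT THE SYMMETRIC LETTERS** (`par := parSymY`, `OA := GAY parSymY parBY (GpY parSymY)`), `rfl`.
[cite: Balaban1985BackgroundPropagators, Thm 3.4 p.400, (3.84)–(3.86) p.407, bookkeeping] -/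
theorem carriersYU_eq_carriersYUPar : carriersYU P G f b ιB C38 ops =
    carriersYUPar P G f b ιB C38 (fun j => parSymY (f j).toKIdx)
      (fun j => GAY (f j).toKIdx (parSymY (f j).toKIdx) (parBY (f j).toKIdx) (GpY (f j).toKIdx (parSymY (f j).toKIdx))) ops := rfl

/-! ### §2a–§2c. The projections at the parameters (`CarriersYU` §2a–§2c re-read; `rfl` ∕ `Iff.rfl`) -/

/-- the index of the bundle is `J`. [cite: Balaban1985BackgroundPropagators, p.399 (the family), bookkeeping] -/
theorem carriersYUPar_I9 : (carriersYUPar P G f b ιB C38 par OA ops).I9 = J := rfl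
/-- the lattice dimension of the bundle is `d + 1`. [cite: Balaban1985BackgroundPropagators, Sect. A p.396, bookkeeping] -/
theorem carriersYUPar_d9 : (carriersYUPar P G f b ιB C38 par OA ops).d9 = d + 1 := rfl
/-- the (3.35) threshold of the bundle is `c35Y`. [cite: Balaban1985BackgroundPropagators, p.396 («≧ 10»), bookkeeping] -/
theorem carriersYUPar_c35 : (carriersYUPar P G f b ιB C38 par OA ops).c35 = c35Y := rfl
/-- … `= 10`. [cite: Balaban1985BackgroundPropagators, p.396 («≧ 10»), bookkeeping] -/
theorem carriersYUPar_c35_eq : (carriersYUPar P G f b ιB C38 par OA ops).c35 = 10 := rfl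
/-- the geometry at `j` is the member `f j`'s. [cite: Balaban1985BackgroundPropagators, Sect. A pp.396–397, bookkeeping] -/
theorem carriersYUPar_geo9 (j : J) : (carriersYUPar P G f b ιB C38 par OA ops).geo9 j = geo9Y (f j) := rfl
/-- **the backgrounds at `j` are the coded carrier of `f j`** at the extended class. [cite: Balaban1985BackgroundPropagators, (3.37)–(3.38) p.396] -/
theorem carriersYUPar_bg9 (j : J) : (carriersYUPar P G f b ιB C38 par OA ops).bg9 j = (codingYU P G f ιB C38 j).bg := rfl
/-- … spelled through `codingYx`. [cite: Balaban1985BackgroundPropagators, (3.37)–(3.38) p.396, bookkeeping] -/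
theorem carriersYUPar_bg9_eq (j : J) : (carriersYUPar P G f b ιB C38 par OA ops).bg9 j = (codingYx P G (f j) (C37GY G (f j) (ιB j) (cqY d)) (C38 j)).bg := rfl
/-- Cor. 3.6's cube predicate at `j` is `InCubeY (f j)`. [cite: Balaban1985BackgroundPropagators, Cor. 3.6 p.408, bookkeeping] -/
theorem carriersYUPar_InCube (j : J) : (carriersYUPar P G f b ιB C38 par OA ops).InCube j = InCubeY (f j) := rfl
/-- **`G′` at `j` is the U-letter site reading `KSCU` at the transporter parameter `par j`.** [cite: Balaban1985BackgroundPropagators, Thm 3.4 p.400, (3.42)–(3.47) pp.397–398] -/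
theorem carriersYUPar_Gp (j : J) :
    (carriersYUPar P G f b ιB C38 par OA ops).Gp j = KSCU P G (f j) (par j) (C37GY G (f j) (ιB j) (cqY d)) (C38 j) := rfl
/-- **`G` at `j` is the U-letter bond reading `KACU`** at the bond-average letter parameter `OA j`, `parBY`. [cite: Balaban1985BackgroundPropagators, Thm 3.4 p.400, (3.84)–(3.86) p.407] -/
theorem carriersYUPar_GA (j : J) :
    (carriersYUPar P G f b ιB C38 par OA ops).GA j = KACU P G (f j) (OA j)
      (parBY (f j).toKIdx) (C37GY G (f j) (ιB j) (cqY d)) (C38 j) := rfl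
/-- `C⁻¹` at `j` is the class-parametric kernel `CinvY P` (`B9SectBKerFrameCodedYR`, bundle `B9SectBCodedChainR4`) at the parameter `par`, read along the decoding, BY NAME (`rfl`). [cite: Balaban1985BackgroundPropagators, Cor. 3.6 p.408, bookkeeping] -/
theorem carriersYUPar_Cinv (j : J) :
    (carriersYUPar P G f b ιB C38 par OA ops).Cinv j = pullS (codingYU P G f ιB C38 j) (CinvY P f G par j) := rfl

/-- FACE: `C⁻¹` at `j` UNFOLDED — the record's (3.48) kernel of the letter `C = CY (par j) (GpY (par j))` at the carrier blocks (the `siteKernelOfOp` reading of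
`Node00.OpsYOfLetters`, = the body of `CinvY P` at `par`) read along the decoding (`rfl`). [cite: Balaban1985BackgroundPropagators, Thm 3.2 (3.48) p.398,
Cor. 3.6 p.408, bookkeeping] -/
theorem carriersYUPar_Cinv_eq_siteKernelOfOp (j : J) :
    (carriersYUPar P G f b ιB C38 par OA ops).Cinv j = pullS (codingYU P G f ιB C38 j)
      (siteKernelOfOp (f j).toKIdx (bg9YC 𝔸 G P (f j)) (fun U => U)
        (CY (f j).toKIdx (par j) (GpY (f j).toKIdx (par j)))
        (β (f j).toKIdx.hN (f j).toKIdx.D (f j).toKIdx.hk) (β (f j).toKIdx.hN (f j).toKIdx.D (f j).toKIdx.hk)) := rfl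
/-- **the analyticity slot at `j` is `IsAnKY … b`.** [cite: Balaban1985BackgroundPropagators, Thm 3.4 p.400 («extend … as analytic functions of A»)] -/
theorem carriersYUPar_IsAnalyticExt (j : J) :
    (carriersYUPar P G f b ιB C38 par OA ops).IsAnalyticExt j = IsAnKY P G (f j) (par j) b (C37GY G (f j) (ιB j) (cqY d)) (C38 j) := rfl
/-- Thm 3.7's expansion at `j` is the record's read along the decoding. [cite: Balaban1985BackgroundPropagators, Thm 3.7 (3.87) p.409, bookkeeping] -/
theorem carriersYUPar_E37 (j : J) : (carriersYUPar P G f b ιB C38 par OA ops).E37 j = pullRW (codingYU P G f ιB C38 j) (rwExpansionR (regC335 𝔸 G P) (regC336 𝔸 G P) (ops (f j)).E37) := rfl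
/-- Thm 3.9's kernel expansion at `j` is the record's read along the decoding. [cite: Balaban1985BackgroundPropagators, Thm 3.9 (3.99) p.413, bookkeeping] -/
theorem carriersYUPar_EK39 (j : J) : (carriersYUPar P G f b ιB C38 par OA ops).EK39 j = pullRWK (codingYU P G f ιB C38 j) (rwKernelExpansionR (regC335 𝔸 G P) (regC336 𝔸 G P) (ops (f j)).EK39) := rfl
/-- Thm 3.10's expansion at `j` is the record's read along the decoding. [cite: Balaban1985BackgroundPropagators, Thm 3.10 pp.415–416, (3.107) p.416, bookkeeping] -/
theorem carriersYUPar_E310 (j : J) : (carriersYUPar P G f b ιB C38 par OA ops).E310 j = pullRW (codingYU P G f ιB C38 j) (rwExpansionR (regC335 𝔸 G P) (regC336 𝔸 G P) (ops (f j)).E310) := rfl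
/-- Thm 3.11's positivity slots at `j` are the record's read along the decoding. [cite: Balaban1985BackgroundPropagators, Thm 3.11 p.416, bookkeeping] -/
theorem carriersYUPar_PosDef (j : J) (n : Fin 5) : (carriersYUPar P G f b ιB C38 par OA ops).PosDef j n = pullC (codingYU P G f ιB C38 j) ((ops (f j)).PosDef n) := rfl
/-- `G(Ω)` (Dirichlet) at `j` is the record's read along the decoding. [cite: Balaban1985BackgroundPropagators, Thm 3.12 p.423, bookkeeping] -/
theorem carriersYUPar_GD (j : J) : (carriersYUPar P G f b ιB C38 par OA ops).GD j = pullK (codingYU P G f ιB C38 j) (kernelFamilyR (regC335 𝔸 G P) (regC336 𝔸 G P) (ops (f j)).GD) := rfl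
/-- `G₁` at `j` is the record's read along the decoding. [cite: Balaban1985BackgroundPropagators, (3.134) p.422, bookkeeping] -/
theorem carriersYUPar_G₁ (j : J) : (carriersYUPar P G f b ιB C38 par OA ops).G₁ j = pullK (codingYU P G f ιB C38 j) (kernelFamilyR (regC335 𝔸 G P) (regC336 𝔸 G P) (ops (f j)).G₁) := rfl
/-- `H` at `j` is the record's read along the decoding. [cite: Balaban1985BackgroundPropagators, (3.133) p.422, bookkeeping] -/
theorem carriersYUPar_H (j : J) : (carriersYUPar P G f b ιB C38 par OA ops).H j = pullH (codingYU P G f ιB C38 j) (hKernelR (regC335 𝔸 G P) (regC336 𝔸 G P) (ops (f j)).H) := rfl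
/-- `H₁` at `j` is the record's read along the decoding. [cite: Balaban1985BackgroundPropagators, (3.133) p.422, bookkeeping] -/
theorem carriersYUPar_H₁ (j : J) : (carriersYUPar P G f b ιB C38 par OA ops).H₁ j = pullH (codingYU P G f ιB C38 j) (hKernelR (regC335 𝔸 G P) (regC336 𝔸 G P) (ops (f j)).H₁) := rfl
/-- «has the random-walk expansion» at `j` is the record's read along the decoding. [cite: Balaban1985BackgroundPropagators, Thm 3.13 p.426, bookkeeping] -/
theorem carriersYUPar_HasRWExp (j : J) : (carriersYUPar P G f b ιB C38 par OA ops).HasRWExp j = pullPK (codingYU P G f ιB C38 j) (fun K => (ops (f j)).HasRWExp (kernelFamilyRY K)) := rfl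
/-- «`H` has the random-walk expansion» at `j` is the record's read along the decoding. [cite: Balaban1985BackgroundPropagators, Thm 3.13 p.426, bookkeeping] -/
theorem carriersYUPar_HasRWExpH (j : J) : (carriersYUPar P G f b ιB C38 par OA ops).HasRWExpH j = pullPH (codingYU P G f ιB C38 j) (fun K => (ops (f j)).HasRWExpH (hKernelRY K)) := rfl
/-- «is positive definite» (on families) at `j` is the record's read along the decoding. [cite: Balaban1985BackgroundPropagators, Thm 3.12 p.423, bookkeeping] -/
theorem carriersYUPar_PosDefK (j : J) : (carriersYUPar P G f b ιB C38 par OA ops).PosDefK j = pullPK₀ (codingYU P G f ιB C38 j) (fun K => (ops (f j)).PosDefK (kernelFamilyRY K)) := rfl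
/-- `G(Ω)` (Thm 3.13's family) at `j` is the record's read along the decoding. [cite: Balaban1985BackgroundPropagators, Thm 3.13 p.426, bookkeeping] -/
theorem carriersYUPar_GG (j : J) : (carriersYUPar P G f b ιB C38 par OA ops).GG j = pullK (codingYU P G f ιB C38 j) (kernelFamilyR (regC335 𝔸 G P) (regC336 𝔸 G P) (ops (f j)).GG) := rfl
/-- Thm 3.14's difference family at `j` is the record's read along the decoding. [cite: Balaban1985BackgroundPropagators, Thm 3.14 p.427, bookkeeping] -/
theorem carriersYUPar_Kdiff (j : J) : (carriersYUPar P G f b ιB C38 par OA ops).Kdiff j = pullK (codingYU P G f ιB C38 j) (kernelFamilyR (regC335 𝔸 G P) (regC336 𝔸 G P) (ops (f j)).Kdiff) := rfl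
/-- (3.154) at `j` is `dOmegaY (f j)`. [cite: Balaban1985BackgroundPropagators, (3.154) p.427, bookkeeping] -/
theorem carriersYUPar_dOmega (j : J) : (carriersYUPar P G f b ιB C38 par OA ops).dOmega j = dOmegaY (f j) := rfl
/-- `C^{(k)}(Λ;U)` at `j` is the record's read along the decoding. [cite: Balaban1985BackgroundPropagators, (3.157) p.428, bookkeeping] -/
theorem carriersYUPar_Ck (j : J) : (carriersYUPar P G f b ιB C38 par OA ops).Ck j = pullS (codingYU P G f ιB C38 j) (siteKernelR (regC335 𝔸 G P) (regC336 𝔸 G P) (ops (f j)).Ck) := rfl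
/-- `Λ` at `j` is `inΛY (f j)`. [cite: Balaban1985BackgroundPropagators, p.427 («Λ … is a union of big blocks»), bookkeeping] -/
theorem carriersYUPar_inΛ (j : J) : (carriersYUPar P G f b ιB C38 par OA ops).inΛ j = inΛY (f j) := rfl
/-- the unit distance at `j` is `unitDistY (f j)`. [cite: Balaban1985BackgroundPropagators, (3.185) p.432, bookkeeping] -/
theorem carriersYUPar_unitDist (j : J) : (carriersYUPar P G f b ιB C38 par OA ops).unitDist j = unitDistY (f j) := rfl
/-- (3.185) at `j` is the record's read along the decoding. [cite: Balaban1985BackgroundPropagators, (3.185) p.432, bookkeeping] -/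
theorem carriersYUPar_GivenBy3185 (j : J) : (carriersYUPar P G f b ιB C38 par OA ops).GivenBy3185 j = pullC (codingYU P G f ιB C38 j) (ops (f j)).GivenBy3185 := rfl
/-- (3.186)'s expansion predicate at `j` is the record's read along the decoding. [cite: Balaban1985BackgroundPropagators, (3.186) p.432, bookkeeping] -/
theorem carriersYUPar_HasRWExpC (j : J) : (carriersYUPar P G f b ιB C38 par OA ops).HasRWExpC j = pullC (codingYU P G f ιB C38 j) (ops (f j)).HasRWExpC := rfl
/-- the (3.49) fine kernel at `j` is the record's read along the decoding. [cite: Balaban1985BackgroundPropagators, (3.49) p.399, bookkeeping] -/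
theorem carriersYUPar_P349 (j : J) : (carriersYUPar P G f b ιB C38 par OA ops).P349 j = pullF (codingYU P G f ιB C38 j) (fineKernelR (regC335 𝔸 G P) (regC336 𝔸 G P) (ops (f j)).P349) := rfl
/-- `QGQ*⁻¹` (3.132) at `j` is the record's read along the decoding. [cite: Balaban1985BackgroundPropagators, (3.132) p.422, bookkeeping] -/
theorem carriersYUPar_QGQinv (j : J) : (carriersYUPar P G f b ιB C38 par OA ops).QGQinv j = pullS (codingYU P G f ιB C38 j) (siteKernelR (regC335 𝔸 G P) (regC336 𝔸 G P) (ops (f j)).QGQinv) := rfl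
/-- `QG₁Q*⁻¹` (3.132) at `j` is the record's read along the decoding. [cite: Balaban1985BackgroundPropagators, (3.132) p.422, bookkeeping] -/
theorem carriersYUPar_QG1Qinv (j : J) : (carriersYUPar P G f b ιB C38 par OA ops).QG1Qinv j = pullS (codingYU P G f ιB C38 j) (siteKernelR (regC335 𝔸 G P) (regC336 𝔸 G P) (ops (f j)).QG1Qinv) := rfl
/-- `Ω_k` at `j` is `OmKY (f j)`. [cite: Balaban1985BackgroundPropagators, Thm 3.14 p.427, bookkeeping] -/
theorem carriersYUPar_OmK (j : J) : (carriersYUPar P G f b ιB C38 par OA ops).OmK j = OmKY (f j) := rfl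

/-- the index of the bundle is inhabited when the subfamily's index is. [cite: Balaban1985BackgroundPropagators, p.399 (the family), bookkeeping] -/
theorem carriersYUPar_nonempty_I9 [h : Nonempty J] : Nonempty (carriersYUPar P G f b ιB C38 par OA ops).I9 := h

/-! ### §2b. At a base code the pulled-back carriers read the record's at `U` (`rfl`) -/

/-- `G(Ω)`'s entries at a base code are the record's at its configuration. [cite: Balaban1985BackgroundPropagators, Thm 3.12 p.423, bookkeeping] -/
theorem carriersYUPar_GD_e_base (j : J) (n : Fin 4) (U : CfgY 𝔸 (f j).toKIdx) :
    ((carriersYUPar P G f b ιB C38 par OA ops).GD j).e n (.base U) = (ops (f j)).GD.e n U := rfl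
/-- `G₁`'s entries at a base code are the record's. [cite: Balaban1985BackgroundPropagators, (3.134) p.422, bookkeeping] -/
theorem carriersYUPar_G₁_e_base (j : J) (n : Fin 4) (U : CfgY 𝔸 (f j).toKIdx) :
    ((carriersYUPar P G f b ιB C38 par OA ops).G₁ j).e n (.base U) = (ops (f j)).G₁.e n U := rfl
/-- `GG`'s entries at a base code are the record's. [cite: Balaban1985BackgroundPropagators, Thm 3.13 p.426, bookkeeping] -/
theorem carriersYUPar_GG_e_base (j : J) (n : Fin 4) (U : CfgY 𝔸 (f j).toKIdx) :
    ((carriersYUPar P G f b ιB C38 par OA ops).GG j).e n (.base U) = (ops (f j)).GG.e n U := rfl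
/-- `Kdiff`'s entries at a base code are the record's. [cite: Balaban1985BackgroundPropagators, Thm 3.14 p.427, bookkeeping] -/
theorem carriersYUPar_Kdiff_e_base (j : J) (n : Fin 4) (U : CfgY 𝔸 (f j).toKIdx) :
    ((carriersYUPar P G f b ιB C38 par OA ops).Kdiff j).e n (.base U) = (ops (f j)).Kdiff.e n U := rfl
/-- `H`'s kernel at a base code is the record's. [cite: Balaban1985BackgroundPropagators, (3.133) p.422, bookkeeping] -/
theorem carriersYUPar_H_h_base (j : J) (U : CfgY 𝔸 (f j).toKIdx) : ((carriersYUPar P G f b ιB C38 par OA ops).H j).h (.base U) = (ops (f j)).H.h U := rfl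
/-- `H₁`'s kernel at a base code is the record's. [cite: Balaban1985BackgroundPropagators, (3.133) p.422, bookkeeping] -/
theorem carriersYUPar_H₁_h_base (j : J) (U : CfgY 𝔸 (f j).toKIdx) : ((carriersYUPar P G f b ιB C38 par OA ops).H₁ j).h (.base U) = (ops (f j)).H₁.h U := rfl
/-- `C^{(k)}(Λ;U)`'s kernel at a base code is the record's. [cite: Balaban1985BackgroundPropagators, (3.157) p.428, bookkeeping] -/
theorem carriersYUPar_Ck_ker_base (j : J) (U : CfgY 𝔸 (f j).toKIdx) : ((carriersYUPar P G f b ιB C38 par OA ops).Ck j).ker (.base U) = (ops (f j)).Ck.ker U := rfl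
/-- `QGQ*⁻¹`'s kernel at a base code is the record's. [cite: Balaban1985BackgroundPropagators, (3.132) p.422, bookkeeping] -/
theorem carriersYUPar_QGQinv_ker_base (j : J) (U : CfgY 𝔸 (f j).toKIdx) : ((carriersYUPar P G f b ιB C38 par OA ops).QGQinv j).ker (.base U) = (ops (f j)).QGQinv.ker U := rfl
/-- `QG₁Q*⁻¹`'s kernel at a base code is the record's. [cite: Balaban1985BackgroundPropagators, (3.132) p.422, bookkeeping] -/
theorem carriersYUPar_QG1Qinv_ker_base (j : J) (U : CfgY 𝔸 (f j).toKIdx) : ((carriersYUPar P G f b ιB C38 par OA ops).QG1Qinv j).ker (.base U) = (ops (f j)).QG1Qinv.ker U := rfl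
/-- the (3.49) fine kernel at a base code is the record's. [cite: Balaban1985BackgroundPropagators, (3.49) p.399, bookkeeping] -/
theorem carriersYUPar_P349_ker_base (j : J) (n : Fin 4) (U : CfgY 𝔸 (f j).toKIdx) :
    ((carriersYUPar P G f b ιB C38 par OA ops).P349 j).ker n (.base U) = (ops (f j)).P349.ker n U := rfl
/-- Thm 3.11's positivity slot at a base code is the record's. [cite: Balaban1985BackgroundPropagators, Thm 3.11 p.416, bookkeeping] -/
theorem carriersYUPar_PosDef_base (j : J) (n : Fin 5) (U : CfgY 𝔸 (f j).toKIdx) : (carriersYUPar P G f b ιB C38 par OA ops).PosDef j n (.base U) = (ops (f j)).PosDef n U := rfl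
/-- (3.185) at a base code is the record's. [cite: Balaban1985BackgroundPropagators, (3.185) p.432, bookkeeping] -/
theorem carriersYUPar_GivenBy3185_base (j : J) (U : CfgY 𝔸 (f j).toKIdx) : (carriersYUPar P G f b ιB C38 par OA ops).GivenBy3185 j (.base U) = (ops (f j)).GivenBy3185 U := rfl
/-- (3.186)'s expansion predicate at a base code is the record's. [cite: Balaban1985BackgroundPropagators, (3.186) p.432, bookkeeping] -/
theorem carriersYUPar_HasRWExpC_base (j : J) (U : CfgY 𝔸 (f j).toKIdx) : (carriersYUPar P G f b ιB C38 par OA ops).HasRWExpC j (.base U) = (ops (f j)).HasRWExpC U := rfl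

/-! ### §2c. The classes of the coded carrier at a base code, unfolded (`Iff.rfl`): what a leaf over the bundle reads as (3.35)–(3.38) -/

/-- the configurations of the coded carrier at `j` are the codes over the member's configurations and the fields `A′`. [cite: Balaban1985BackgroundPropagators, (3.37) p.396 («U′ = exp iηA′»), bookkeeping] -/
theorem carriersYUPar_bg9_Cfg (j : J) : ((carriersYUPar P G f b ιB C38 par OA ops).bg9 j).Cfg = CCfg (CfgY 𝔸 (f j).toKIdx) (AfldY 𝔸 (f j).toKIdx) := rfl
/-- **(3.35) of the coded carrier at a base code READS the parameter's `(«U is G-valued» ∧ P.P₁) ∧ P.P₂` at the member `f j`.** [cite: Balaban1985BackgroundPropagators, (3.35) p.396 («U with values in G … O(1)»)] -/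
theorem carriersYUPar_bg9_Reg335_base_iff (j : J) (c α₀ : ℝ) (U : CfgY 𝔸 (f j).toKIdx) :
    ((carriersYUPar P G f b ιB C38 par OA ops).bg9 j).Reg335 c α₀ (.base U) ↔ (GVal G (f j).toKIdx U ∧ P.P₁ (f j) c α₀ U) ∧ P.P₂ (f j) c α₀ U := Iff.rfl
/-- … i.e. the class-parametric member carrier's (3.35) at `U`. [cite: Balaban1985BackgroundPropagators, (3.35) p.396, bookkeeping] -/
theorem carriersYUPar_bg9_Reg335_base_iff_bg9YC (j : J) (c α₀ : ℝ) (U : CfgY 𝔸 (f j).toKIdx) :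
    ((carriersYUPar P G f b ιB C38 par OA ops).bg9 j).Reg335 c α₀ (.base U) ↔ (bg9YC 𝔸 G P (f j)).Reg335 c α₀ U := Iff.rfl
/-- **(3.36) of the coded carrier at a base code READS the parameter's `(«U is G-valued» ∧ P.Q₁) ∧ P.Q₂` at `f j`.** [cite: Balaban1985BackgroundPropagators, (3.36) p.396] -/
theorem carriersYUPar_bg9_Reg336_base_iff (j : J) (c α₀ : ℝ) (U : CfgY 𝔸 (f j).toKIdx) :
    ((carriersYUPar P G f b ιB C38 par OA ops).bg9 j).Reg336 c α₀ (.base U) ↔ (GVal G (f j).toKIdx U ∧ P.Q₁ (f j) c α₀ U) ∧ P.Q₂ (f j) c α₀ U := Iff.rfl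
/-- no multiplier code `U′` is (3.35)-regular (the classes (3.35)–(3.36) live on the base codes). [cite: Balaban1985BackgroundPropagators, (3.35), (3.37) p.396, bookkeeping] -/
theorem carriersYUPar_bg9_not_Reg335_mult (j : J) (c α₀ : ℝ) (a : AfldY 𝔸 (f j).toKIdx) : ¬ ((carriersYUPar P G f b ιB C38 par OA ops).bg9 j).Reg335 c α₀ (.mult a) := fun h => h
/-- no product code `U′U` is (3.35)-regular. [cite: Balaban1985BackgroundPropagators, (3.35), (3.37) p.396, bookkeeping] -/
theorem carriersYUPar_bg9_not_Reg335_prod (j : J) (c α₀ : ℝ) (U : CfgY 𝔸 (f j).toKIdx) (a : AfldY 𝔸 (f j).toKIdx) :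
    ¬ ((carriersYUPar P G f b ιB C38 par OA ops).bg9 j).Reg335 c α₀ (.prod U a) := fun h => h
/-- **(3.37) of the coded carrier between a base code and a multiplier code READS the extended class `C37GY … (cqY d)`.** [cite: Balaban1985BackgroundPropagators, (3.37) p.396] -/
theorem carriersYUPar_bg9_Cplx337_base_mult_iff (j : J) (α : ℝ) (U : CfgY 𝔸 (f j).toKIdx) (a : AfldY 𝔸 (f j).toKIdx) :
    ((carriersYUPar P G f b ιB C38 par OA ops).bg9 j).Cplx337 α (.base U) (.mult a) ↔ C37GY G (f j) (ιB j) (cqY d) α U a := Iff.rfl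
/-- **(3.38) of the coded carrier between a base code and a multiplier code READS the parameter class `C38 j`.** [cite: Balaban1985BackgroundPropagators, (3.38) p.396] -/
theorem carriersYUPar_bg9_Cplx338_base_mult_iff (j : J) (α : ℝ) (U : CfgY 𝔸 (f j).toKIdx) (a : AfldY 𝔸 (f j).toKIdx) :
    ((carriersYUPar P G f b ιB C38 par OA ops).bg9 j).Cplx338 α (.base U) (.mult a) ↔ C38 j α U a := Iff.rfl
/-- the carrier's product of a multiplier code with a base code is the product code (decoding to `U′U`). [cite: Balaban1985BackgroundPropagators, (3.37) p.396 («U′U»), bookkeeping] -/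
theorem carriersYUPar_bg9_mul_mult_base (j : J) (U : CfgY 𝔸 (f j).toKIdx) (a : AfldY 𝔸 (f j).toKIdx) :
    ((carriersYUPar P G f b ιB C38 par OA ops).bg9 j).mul (.mult a) (.base U) = .prod U a := rfl

end Bundle

/-! ## §3. At the record: `M_N(ℂ)`, `SU(N)` — `Y9OfRecordUPar`, `Y9OfRecordUPbPar` -/

section Record

variable (N : ℕ)

/-- ★★ **THE [B9] CARRIER BUNDLE OF RECORD OVER THE CODED CARRIER, PARAMETRIC IN THE SITE TRANSPORTER AND THE BOND-AVERAGE LETTER**: `carriersYUPar` at `M_N(ℂ)`, `SU(N)`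
(cf. `Y9OfRecordU`). [cite: Balaban1985BackgroundPropagators, Thm 3.4 p.400, (3.37)–(3.38) p.396, (3.115) p.418, Thms 3.1–3.15 pp.397–432] -/
def Y9OfRecordUPar (θ : Stage3Params) (Mstar : ℕ) (P : RegExtraY θ.d₆ θ.ℓ₆ θ.hd' θ.hL' θ.b₀ θ.b₁ Mstar (Matrix (Fin N) (Fin N) ℂ)) (ops : OpsY N θ Mstar) {J : Type} (f : J → MemberY θ.d₆ θ.ℓ₆ θ.hd' θ.hL' θ.b₀ θ.b₁ Mstar)
    {ι : Type} [Fintype ι] (b : Module.Basis ι ℝ (Matrix (Fin N) (Fin N) ℂ))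
    (ιB : ∀ j : J, BlkY (f j).toKIdx → IBondY (f j).toKIdx)
    (C38 : ∀ j : J, ℝ → CfgY (Matrix (Fin N) (Fin N) ℂ) (f j).toKIdx → AfldY (Matrix (Fin N) (Fin N) ℂ) (f j).toKIdx → Prop)
    (par : ∀ j : J, SiteParY (Matrix (Fin N) (Fin N) ℂ) (f j).toKIdx) (OA : ∀ j : J, BondOpY (Matrix (Fin N) (Fin N) ℂ) (f j).toKIdx) : PrintedCarriers9X :=
  carriersYUPar P (specialUnitaryUnits (Fin N)) f b ιB C38 par OA ops

variable {N}
variable (θ : Stage3Params) (Mstar : ℕ) (P : RegExtraY θ.d₆ θ.ℓ₆ θ.hd' θ.hL' θ.b₀ θ.b₁ Mstar (Matrix (Fin N) (Fin N) ℂ)) (ops : OpsY N θ Mstar) {J : Type} (f : J → MemberY θ.d₆ θ.ℓ₆ θ.hd' θ.hL' θ.b₀ θ.b₁ Mstar)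
  {ι : Type} [Fintype ι] (b : Module.Basis ι ℝ (Matrix (Fin N) (Fin N) ℂ))
  (ιB : ∀ j : J, BlkY (f j).toKIdx → IBondY (f j).toKIdx)
  (C38 : ∀ j : J, ℝ → CfgY (Matrix (Fin N) (Fin N) ℂ) (f j).toKIdx → AfldY (Matrix (Fin N) (Fin N) ℂ) (f j).toKIdx → Prop)
  (par : ∀ j : J, SiteParY (Matrix (Fin N) (Fin N) ℂ) (f j).toKIdx) (OA : ∀ j : J, BondOpY (Matrix (Fin N) (Fin N) ℂ) (f j).toKIdx)

/-- ★ today's `Y9OfRecordU` IS the instance at the symmetric letters (`rfl`). [cite: Balaban1985BackgroundPropagators, Thm 3.4 p.400, (3.84)–(3.86) p.407, bookkeeping] -/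
theorem Y9OfRecordU_eq_Y9OfRecordUPar : Y9OfRecordU N θ Mstar P ops f b ιB C38 =
    Y9OfRecordUPar N θ Mstar P ops f b ιB C38 (fun j => parSymY (f j).toKIdx)
      (fun j => GAY (f j).toKIdx (parSymY (f j).toKIdx) (parBY (f j).toKIdx) (GpY (f j).toKIdx (parSymY (f j).toKIdx))) := rfl

/-- `Y9OfRecordUPar` unfolded (`rfl`). [cite: Balaban1985BackgroundPropagators, Thm 3.4 p.400, bookkeeping] -/
theorem Y9OfRecordUPar_eq : Y9OfRecordUPar N θ Mstar P ops f b ιB C38 par OA = carriersYUPar P (specialUnitaryUnits (Fin N)) f b ιB C38 par OA ops := rfl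
/-- the index of the bundle of record over the coded carrier is `J`. [cite: Balaban1985BackgroundPropagators, p.399, bookkeeping] -/
theorem Y9OfRecordUPar_I9 : (Y9OfRecordUPar N θ Mstar P ops f b ιB C38 par OA).I9 = J := rfl
/-- … inhabited when `J` is. [cite: Balaban1985BackgroundPropagators, p.399, bookkeeping] -/
theorem Y9OfRecordUPar_nonempty_I9 [h : Nonempty J] : Nonempty (Y9OfRecordUPar N θ Mstar P ops f b ιB C38 par OA).I9 := h
/-- **the backgrounds of record over the coded carrier at `j`** = the coding of `bg9Y (M_N(ℂ)) SU(N) (f j)` at the extended class. [cite: Balaban1985BackgroundPropagators, (3.37)–(3.38) p.396] -/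
theorem Y9OfRecordUPar_bg9 (j : J) : (Y9OfRecordUPar N θ Mstar P ops f b ιB C38 par OA).bg9 j = (codingYU P (specialUnitaryUnits (Fin N)) f ιB C38 j).bg := rfl
/-- **`G′` of record over the coded carrier at `j`** = `KSCU` at `SU(N)`, `par j`. [cite: Balaban1985BackgroundPropagators, Thm 3.4 p.400] -/
theorem Y9OfRecordUPar_Gp (j : J) : (Y9OfRecordUPar N θ Mstar P ops f b ιB C38 par OA).Gp j =
    KSCU P (specialUnitaryUnits (Fin N)) (f j) (par j) (C37GY (specialUnitaryUnits (Fin N)) (f j) (ιB j) (cqY θ.d₆)) (C38 j) := rfl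
/-- **`G` of record over the coded carrier at `j`** = `KACU` at `SU(N)`, `OA j`, `parBY`. [cite: Balaban1985BackgroundPropagators, Thm 3.4 p.400] -/
theorem Y9OfRecordUPar_GA (j : J) : (Y9OfRecordUPar N θ Mstar P ops f b ιB C38 par OA).GA j =
    KACU P (specialUnitaryUnits (Fin N)) (f j) (OA j)
      (parBY (f j).toKIdx) (C37GY (specialUnitaryUnits (Fin N)) (f j) (ιB j) (cqY θ.d₆)) (C38 j) := rfl
/-- `C⁻¹` of record over the coded carrier at `j` = `CinvY P` read along the decoding (by name, `rfl`). [cite: Balaban1985BackgroundPropagators, Cor. 3.6 p.408,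
bookkeeping] -/
theorem Y9OfRecordUPar_Cinv (j : J) : (Y9OfRecordUPar N θ Mstar P ops f b ιB C38 par OA).Cinv j =
    pullS (codingYU P (specialUnitaryUnits (Fin N)) f ιB C38 j) (CinvY P f (specialUnitaryUnits (Fin N)) par j) := rfl
/-- **the analyticity slot of record over the coded carrier at `j`** = `IsAnKY … b`. [cite: Balaban1985BackgroundPropagators, Thm 3.4 p.400] -/
theorem Y9OfRecordUPar_IsAnalyticExt (j : J) : (Y9OfRecordUPar N θ Mstar P ops f b ιB C38 par OA).IsAnalyticExt j =
    IsAnKY P (specialUnitaryUnits (Fin N)) (f j) (par j) b (C37GY (specialUnitaryUnits (Fin N)) (f j) (ιB j) (cqY θ.d₆)) (C38 j) := rfl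
/-- `G(Ω)` of record over the coded carrier at `j` = the operator layer's read along the decoding. [cite: Balaban1985BackgroundPropagators, Thm 3.12 p.423, bookkeeping] -/
theorem Y9OfRecordUPar_GD (j : J) : (Y9OfRecordUPar N θ Mstar P ops f b ιB C38 par OA).GD j =
    pullK (codingYU P (specialUnitaryUnits (Fin N)) f ιB C38 j) (kernelFamilyR (regC335 (Matrix (Fin N) (Fin N) ℂ) (specialUnitaryUnits (Fin N)) P) (regC336 (Matrix (Fin N) (Fin N) ℂ) (specialUnitaryUnits (Fin N)) P) (ops (f j)).GD) := rfl
/-- `C^{(k)}(Λ;U)` of record over the coded carrier at `j` = the operator layer's read along the decoding. [cite: Balaban1985BackgroundPropagators, (3.157) p.428, bookkeeping] -/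
theorem Y9OfRecordUPar_Ck (j : J) : (Y9OfRecordUPar N θ Mstar P ops f b ιB C38 par OA).Ck j =
    pullS (codingYU P (specialUnitaryUnits (Fin N)) f ιB C38 j) (siteKernelR (regC335 (Matrix (Fin N) (Fin N) ℂ) (specialUnitaryUnits (Fin N)) P) (regC336 (Matrix (Fin N) (Fin N) ℂ) (specialUnitaryUnits (Fin N)) P) (ops (f j)).Ck) := rfl
/-- (3.185) of record over the coded carrier at `j` = the operator layer's read along the decoding. [cite: Balaban1985BackgroundPropagators, (3.185) p.432, bookkeeping] -/
theorem Y9OfRecordUPar_GivenBy3185 (j : J) :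
    (Y9OfRecordUPar N θ Mstar P ops f b ιB C38 par OA).GivenBy3185 j = pullC (codingYU P (specialUnitaryUnits (Fin N)) f ιB C38 j) (ops (f j)).GivenBy3185 := rfl

/-! ### §3a. The geometric fields agree with the record bundle `Y9OfRecordP` along `f` (`rfl`) -/

/-- the geometry of record over the coded carrier at `j` is the record bundle's at `f j`. [cite: Balaban1985BackgroundPropagators, Sect. A pp.396–397, bookkeeping] -/
theorem Y9OfRecordUPar_geo9 (j : J) : (Y9OfRecordUPar N θ Mstar P ops f b ιB C38 par OA).geo9 j = (Y9OfRecordP N θ Mstar ops).geo9 (f j) := rfl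
/-- the cube predicate agrees along `f`. [cite: Balaban1985BackgroundPropagators, Cor. 3.6 p.408, bookkeeping] -/
theorem Y9OfRecordUPar_InCube (j : J) : (Y9OfRecordUPar N θ Mstar P ops f b ιB C38 par OA).InCube j = (Y9OfRecordP N θ Mstar ops).InCube (f j) := rfl
/-- (3.154) agrees along `f`. [cite: Balaban1985BackgroundPropagators, (3.154) p.427, bookkeeping] -/
theorem Y9OfRecordUPar_dOmega (j : J) : (Y9OfRecordUPar N θ Mstar P ops f b ιB C38 par OA).dOmega j = (Y9OfRecordP N θ Mstar ops).dOmega (f j) := rfl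
/-- `Λ` agrees along `f`. [cite: Balaban1985BackgroundPropagators, p.427, bookkeeping] -/
theorem Y9OfRecordUPar_inΛ (j : J) : (Y9OfRecordUPar N θ Mstar P ops f b ιB C38 par OA).inΛ j = (Y9OfRecordP N θ Mstar ops).inΛ (f j) := rfl
/-- the unit distance agrees along `f`. [cite: Balaban1985BackgroundPropagators, (3.185) p.432, bookkeeping] -/
theorem Y9OfRecordUPar_unitDist (j : J) : (Y9OfRecordUPar N θ Mstar P ops f b ιB C38 par OA).unitDist j = (Y9OfRecordP N θ Mstar ops).unitDist (f j) := rfl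
/-- `Ω_k` agrees along `f`. [cite: Balaban1985BackgroundPropagators, Thm 3.14 p.427, bookkeeping] -/
theorem Y9OfRecordUPar_OmK (j : J) : (Y9OfRecordUPar N θ Mstar P ops f b ιB C38 par OA).OmK j = (Y9OfRecordP N θ Mstar ops).OmK (f j) := rfl
/-- the (3.35) threshold agrees (`= 10`). [cite: Balaban1985BackgroundPropagators, p.396 («≧ 10»), bookkeeping] -/
theorem Y9OfRecordUPar_c35 : (Y9OfRecordUPar N θ Mstar P ops f b ιB C38 par OA).c35 = (Y9OfRecordP N θ Mstar ops).c35 := rfl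
/-- the lattice dimension agrees. [cite: Balaban1985BackgroundPropagators, Sect. A p.396, bookkeeping] -/
theorem Y9OfRecordUPar_d9 : (Y9OfRecordUPar N θ Mstar P ops f b ιB C38 par OA).d9 = (Y9OfRecordP N θ Mstar ops).d9 := rfl

/-- **(3.35) of the bundle of record over the coded carrier at a base code READS the parameter's conjunction at `f j`.** [cite: Balaban1985BackgroundPropagators, (3.35) p.396] -/
theorem Y9OfRecordUPar_bg9_Reg335_base_iff (j : J) (c α₀ : ℝ) (U : CfgY (Matrix (Fin N) (Fin N) ℂ) (f j).toKIdx) :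
    ((Y9OfRecordUPar N θ Mstar P ops f b ιB C38 par OA).bg9 j).Reg335 c α₀ (.base U) ↔
      (GVal (specialUnitaryUnits (Fin N)) (f j).toKIdx U ∧ P.P₁ (f j) c α₀ U) ∧ P.P₂ (f j) c α₀ U := Iff.rfl

/-! ### §3b. At the record's reading of print's class: `P := extraYPb` -/

variable (N) in
/-- ★★ **THE PARAMETRIC BUNDLE OF RECORD AT THE RECORD's READING OF PRINT's CLASS (3.35)–(3.36)** (`P := extraYPb (M_N ℂ) SU(N)`; cf. `Y9OfRecordUPb`): NAMES the
class instance; asserts nothing about it. [cite: Balaban1985BackgroundPropagators, (3.35)–(3.36) p.396 («O(1) … a number ≧ 10»), Thm 3.4 p.400] -/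
def Y9OfRecordUPbPar : PrintedCarriers9X :=
  Y9OfRecordUPar N θ Mstar (extraYPb (Matrix (Fin N) (Fin N) ℂ) (specialUnitaryUnits (Fin N))) ops f b ιB C38 par OA

/-- `Y9OfRecordUPbPar` unfolded (`rfl`). [cite: Balaban1985BackgroundPropagators, (3.35) p.396, bookkeeping] -/
theorem Y9OfRecordUPbPar_eq :
    Y9OfRecordUPbPar N θ Mstar ops f b ιB C38 par OA = Y9OfRecordUPar N θ Mstar (extraYPb (Matrix (Fin N) (Fin N) ℂ) (specialUnitaryUnits (Fin N))) ops f b ιB C38 par OA := rfl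
/-- … through `carriersYUPar`. [cite: Balaban1985BackgroundPropagators, (3.35) p.396, bookkeeping] -/
theorem Y9OfRecordUPbPar_eq_carriersYUPar : Y9OfRecordUPbPar N θ Mstar ops f b ιB C38 par OA =
    carriersYUPar (extraYPb (Matrix (Fin N) (Fin N) ℂ) (specialUnitaryUnits (Fin N))) (specialUnitaryUnits (Fin N)) f b ιB C38 par OA ops := rfl
/-- the index of the bundle is `J`. [cite: Balaban1985BackgroundPropagators, p.399, bookkeeping] -/
theorem Y9OfRecordUPbPar_I9 : (Y9OfRecordUPbPar N θ Mstar ops f b ιB C38 par OA).I9 = J := rfl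
/-- … inhabited when `J` is. [cite: Balaban1985BackgroundPropagators, p.399, bookkeeping] -/
theorem Y9OfRecordUPbPar_nonempty_I9 [h : Nonempty J] : Nonempty (Y9OfRecordUPbPar N θ Mstar ops f b ιB C38 par OA).I9 := h
/-- **(3.35) of the bundle at the record's reading, at a base code, SPELLED OUT**: «`U` is `SU(N)`-valued», «`0 ≤ α₀`» and print's cube condition (3.35) at threshold `10` and
`M·α₀` at the member's index, and MODULE 2-P's (3.35) at the second pin. [cite: Balaban1985BackgroundPropagators, (3.35) p.396 («|U(∂p) − 1| < α₀ M … O(1)»)] -/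
theorem Y9OfRecordUPbPar_bg9_Reg335_base_iff (j : J) (c α₀ : ℝ) (U : CfgY (Matrix (Fin N) (Fin N) ℂ) (f j).toKIdx) :
    ((Y9OfRecordUPbPar N θ Mstar ops f b ιB C38 par OA).bg9 j).Reg335 c α₀ (.base U) ↔
      (GVal (specialUnitaryUnits (Fin N)) (f j).toKIdx U ∧
          (0 ≤ α₀ ∧ B9BackgroundsKLevelV1P.Reg335PC (Matrix (Fin N) (Fin N) ℂ) (f j).toKIdx (B9BackgroundsKLevelV1P.cubeClassP (f j).toKIdx c35Y)
            ((B6KLevelCensusIndexV1.kGeo (f j).toKIdx).M * α₀) U)) ∧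
        (bg9KP (Matrix (Fin N) (Fin N) ℂ) (specialUnitaryUnits (Fin N)) (f j).snd).Reg335 c35Y α₀ U := Iff.rfl
/-- **(3.36) of the bundle at the record's reading, at a base code, SPELLED OUT** likewise. [cite: Balaban1985BackgroundPropagators, (3.36) p.396] -/
theorem Y9OfRecordUPbPar_bg9_Reg336_base_iff (j : J) (c α₀ : ℝ) (U : CfgY (Matrix (Fin N) (Fin N) ℂ) (f j).toKIdx) :
    ((Y9OfRecordUPbPar N θ Mstar ops f b ιB C38 par OA).bg9 j).Reg336 c α₀ (.base U) ↔
      (GVal (specialUnitaryUnits (Fin N)) (f j).toKIdx U ∧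
          (0 ≤ α₀ ∧ B9BackgroundsKLevelV1P.Reg336PC (Matrix (Fin N) (Fin N) ℂ) (f j).toKIdx (B9BackgroundsKLevelV1P.cubeClassP (f j).toKIdx c35Y)
            ((B6KLevelCensusIndexV1.kGeo (f j).toKIdx).M * α₀) U)) ∧
        (bg9KP (Matrix (Fin N) (Fin N) ℂ) (specialUnitaryUnits (Fin N)) (f j).snd).Reg336 c35Y α₀ U := Iff.rfl
/-- the geometric fields of the bundle at the record's reading agree with `Y9OfRecordP`'s along `f` (`rfl`). [cite: Balaban1985BackgroundPropagators, Sect. A pp.396–397, bookkeeping] -/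
theorem Y9OfRecordUPbPar_geo9 (j : J) : (Y9OfRecordUPbPar N θ Mstar ops f b ιB C38 par OA).geo9 j = (Y9OfRecordP N θ Mstar ops).geo9 (f j) := rfl

/-- ★ today's `Y9OfRecordUPb` IS the instance at the symmetric letters (`rfl`). [cite: Balaban1985BackgroundPropagators, Thm 3.4 p.400, (3.84)–(3.86) p.407, bookkeeping] -/
theorem Y9OfRecordUPb_eq_Y9OfRecordUPbPar : Y9OfRecordUPb N θ Mstar ops f b ιB C38 =
    Y9OfRecordUPbPar N θ Mstar ops f b ιB C38 (fun j => parSymY (f j).toKIdx)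
      (fun j => GAY (f j).toKIdx (parSymY (f j).toKIdx) (parBY (f j).toKIdx) (GpY (f j).toKIdx (parSymY (f j).toKIdx))) := rfl

end Record

end Literature.MathematicalPhysics.QuantumFieldTheory.Balaban1983to89.Node00

end
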